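/-
Copyright: cell `pub-balaban-gaps` (G2), seat ne6 (row NE7b), `prover-pub-balaban-gaps-ne6-g15-0`. Released under the licence of the surrounding project.
-/
import Summits.QuantumFields.BalabanUV.T4Continuum.Spine.NE7b.CompactFibreWindowSUN
import Literature.MathematicalPhysics.QuantumFieldTheory.Balaban1983to89.B16ZLower

/-!
# THE WINDOW-VOLUME LETTER FOR `SU(N)` AT PRINT's RATE WITH AN EXPLICIT CONSTANT, ALL `N ≥ 1` — BY NAME from the tree's covering bound
# `B16ZLower.haarReal_suOpBall_ge` (`Haar_{SU(N)}{‖V − 1‖_op ≤ r} ≥ (4π∕((2N+1)r))·(r∕(16π+r))^{N²}`): for the Hilbert–Schmidt window of `CompactFibreWindowSUN`,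
# `−log Haar_{SU(N)}{‖V − 1‖_HS ≤ η} ≤ (N² − 1)·log η⁻¹ + c_N`, `c_N = ((N² − 1)∕2)·log N + N²·log(16π + 2) + log((2N + 1)∕(4π))` (`0 < η ≤ 2`) (row NE7b, node U5c)

Cell `pub-balaban-gaps` (G2 spine census, V33) for the `pub-balaban` T⁴ crux NE7b (`T4WeightBudget.RelWeightBound`; the cell's OWN estimate — NOT PRINTED in [Bałaban 1983–89], NOT
PROVED).  Crux-route work under `Spine/NE7b/`; NOTHING of Bałaban's is named or asserted; no `def`; zero `sorry`.  Imports: this seat's `CompactFibreWindowSUN` (V20) and the tree's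
`Balaban1983to89.B16ZLower` (cell `pub-balaban` b2b lineage: the explicit `SU(N)` small-ball bound by the phase decomposition and a traceless net, `[NeZero N]`; its `HaarData.haar` is
`haarProbability` by `rfl`; `MatrixNorms` for [Balaban1985Averaging] (20) `‖X‖ ≤ |X|`).

WHY.  `CompactFibreWindowSUNRate` (V29, this gen) delivers the letter at print's rate `N² − 1` for all `N` with SOFT constants (the tree's [VaropoulosSaloffcosteCoulhon1993] Thm. V.4.1
road: compactness constants).  The tree ALSO holds an EXPLICIT lower bound at the sharp exponent in the operator norm (`B16ZLower.haarReal_suOpBall_ge`).  THIS FILE transfers it to V20's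
Hilbert–Schmidt window (`‖X‖_HS ≤ √N·‖X‖_op`, so the op-ball of radius `η∕√N` lies inside) and spells the per-bond letter with every constant a closed expression in `N` — the row's
«numbers, not adjectives» form of the rate-`(N² − 1)` price.

WHAT IS PROVED ([folklore]; `N ≥ 1` as `[NeZero N]`):
* §1 `opBall_subset_sball` (`{‖V − 1‖_op ≤ η∕√N} ⊆ {‖V − 1‖_HS ≤ η}` in `SU(N)`), **`haarReal_sball_ge_explicit`** (`(4π√N∕((2N+1)η))·((η∕√N)∕(16π + η∕√N))^{N²} ≤ Haar_{SU(N)}{‖V − 1‖_HS ≤ η}`, `η > 0`).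
* §2 **`neg_log_haar_sball_le_explicit`** (`0 < η ≤ 2`: `−log Haar(SB η) ≤ (N² − 1)·log η⁻¹ + c_N`, `c_N` as in the title), `haar_sball_real_pos`.
* §3 region: **`neg_log_pi_sball_le_explicit`** (`−log κ(Π_b SB η) ≤ #bonds·((N² − 1)·log η⁻¹ + c_N)`) and the junction with the OWNER's display `compactFibre_moment_le_SUNwindow_explicit`
  (price `exp(i⁺ + #bonds·((N² − 1)·log η⁻¹ + c_N))`, V20's `compactFibre_moment_le_window_exp` BY NAME).

HONEST REMARKS.  (a) The constant `c_N` is the tree's covering constant moved to the Hilbert–Schmidt window, not print's `log σ₀`; it is not optimal (`N = 2`: `c_2 = (3∕2)log 2 + 4 log(16π + 2) +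
log(5∕4π) ≈ 15.9` vs `CompactFibreWindowSU2Rate`'s `log 160 ≈ 5.1` for the trace window).  (b) Only the LOWER half (the price) is explicit here; the two-sided law and the RATE limits are
V29's.  (c) Which window ∕ `η(g_j)` print uses at a creation step and that Bałaban's creation-level carrier IS the compact-fibre one are (A3) ∕ (A1c) readings — NOT asserted.  Nothing of
Bałaban's is asserted, valued or discharged.  NE7b NOT PRINTED ∕ NOT PROVED; spine PROVED 0∕9; rung (B)+1 on a FINITE torus — NOT infinite volume, NOT the mass gap, NOT Clay.
HONEST DEPENDENCY: continuum YM on T⁴ ⇐ BetaPertH ∧ nine spine estimates (0/9 proved); BetaPertH ⇐ (D1) ∧ (D4) ∧ CAP+tail;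
G-an2-4 gates asym, D1 and NE2/3/4.  This file changes none of it.
-/

set_option autoImplicit false

open MeasureTheory Real Finset
open scoped ENNReal
open Literature.MathematicalPhysics.QuantumFieldTheory (haarProbability)
open Literature.MathematicalPhysics.QuantumFieldTheory.Balaban1983to89 (HaarData)
open Literature.MathematicalPhysics.QuantumFieldTheory.Balaban1983to89.MatrixNorms (nhsNormSq_le_opNorm_sq nhsNormSq)

namespace Summit.QuantumFields.BalabanUV.T4Continuum.NE7b.CompactFibreWindowSUNExplicit

noncomputable section

variable {N : ℕ} [NeZero N]

/-! ## §1 The explicit operator-norm bound of the tree, moved to the Hilbert–Schmidt window -/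

section OpNorm

open scoped Matrix.Norms.L2Operator

/-- In the operator norm: the tree's `B16ZLower.haarReal_suOpBall_ge` for the Haar PROBABILITY of `SU(N)` (`HaarData.haar = haarProbability` by `rfl`):
`(4π∕((2N+1)r))·(r∕(16π+r))^{N²} ≤ Haar_{SU(N)}{‖V − 1‖_op ≤ r}`, `r > 0`. [folklore] -/
theorem haarReal_opBall_ge_explicit {r : ℝ} (hr : 0 < r) :
    4 * π / ((2 * N + 1) * r) * (r / (16 * π + r)) ^ (N * N) ≤ (haarProbability (Matrix.specialUnitaryGroup (Fin N) ℂ)).real {V : Matrix.specialUnitaryGroup (Fin N) ℂ | ‖(V : Matrix (Fin N) (Fin N) ℂ) - 1‖ ≤ r} :=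
  Literature.MathematicalPhysics.QuantumFieldTheory.Balaban1983to89.B16ZLower.haarReal_suOpBall_ge hr

/-- The entrywise sum of squares is at most `N·‖·‖²_op` ([Balaban1985Averaging] (20) `‖X‖ ≤ |X|`; tree `MatrixNorms.nhsNormSq_le_opNorm_sq`), in the form `‖A‖_op ≤ η∕√N ⇒ Σ|A_{ij}|² ≤ η²`. [folklore] -/
theorem sum_norm_sq_le_sq_of_opNorm_le_div {A : Matrix (Fin N) (Fin N) ℂ} {η : ℝ} (h : ‖A‖ ≤ η / Real.sqrt N) : ∑ i, ∑ j, ‖A i j‖ ^ 2 ≤ η ^ 2 := by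
  have hN : (0 : ℝ) < N := by exact_mod_cast Nat.pos_of_ne_zero (NeZero.ne N)
  have hsN : 0 < Real.sqrt N := Real.sqrt_pos.2 hN
  have h1 := nhsNormSq_le_opNorm_sq A
  unfold nhsNormSq at h1
  rw [Fintype.card_fin, div_le_iff₀ hN] at h1
  have h2 : ‖A‖ ^ 2 ≤ (η / Real.sqrt N) ^ 2 := pow_le_pow_left₀ (norm_nonneg _) h 2
  rw [div_pow, Real.sq_sqrt hN.le] at h2
  have h3 : ‖A‖ ^ 2 * N ≤ η ^ 2 := by rwa [le_div_iff₀ hN] at h2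
  linarith

end OpNorm

section HS

open scoped Matrix.Norms.Frobenius

/-- The op-ball of radius `η∕√N` lies inside the Hilbert–Schmidt window of radius `η` (`η ≥ 0`; `‖X‖²_HS = Σ|X_{ij}|²`, tree `UnitaryCayley.frobenius_norm_sq`). [folklore] -/
theorem opBall_subset_sball {η : ℝ} (hη : 0 ≤ η) :
    {V : Matrix.specialUnitaryGroup (Fin N) ℂ | @Norm.norm _ Matrix.instL2OpNormedAddCommGroup.toNorm ((V : Matrix (Fin N) (Fin N) ℂ) - 1) ≤ η / Real.sqrt N} ⊆
      {V : Matrix.specialUnitaryGroup (Fin N) ℂ | ‖(V : Matrix (Fin N) (Fin N) ℂ) - 1‖ ≤ η} := by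
  intro V hV
  have h := sum_norm_sq_le_sq_of_opNorm_le_div hV
  rw [Set.mem_setOf_eq, ← pow_le_pow_iff_left₀ (norm_nonneg _) hη two_ne_zero, Literature.MathematicalPhysics.QuantumFieldTheory.UnitaryCayley.frobenius_norm_sq]
  exact h

/-- **THE EXPLICIT LOWER BOUND FOR THE HILBERT–SCHMIDT WINDOW OF `SU(N)`**, `η > 0`: `(4π∕((2N+1)(η∕√N)))·((η∕√N)∕(16π + η∕√N))^{N²} ≤ Haar_{SU(N)}{‖V − 1‖_HS ≤ η}` — exponent `N² − 1` net in `η`,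
every constant a closed expression in `N`. [folklore] -/
theorem haarReal_sball_ge_explicit {η : ℝ} (hη : 0 < η) :
    4 * π / ((2 * N + 1) * (η / Real.sqrt N)) * ((η / Real.sqrt N) / (16 * π + η / Real.sqrt N)) ^ (N * N) ≤
      (haarProbability (Matrix.specialUnitaryGroup (Fin N) ℂ)).real {V : Matrix.specialUnitaryGroup (Fin N) ℂ | ‖(V : Matrix (Fin N) (Fin N) ℂ) - 1‖ ≤ η} := by
  have hN : (0 : ℝ) < N := by exact_mod_cast Nat.pos_of_ne_zero (NeZero.ne N)
  have hr : 0 < η / Real.sqrt N := div_pos hη (Real.sqrt_pos.2 hN)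
  exact (haarReal_opBall_ge_explicit hr).trans (measureReal_mono (opBall_subset_sball hη.le))

/-- Hence the window has positive mass (`η > 0`). [folklore] -/
theorem haar_sball_real_pos {η : ℝ} (hη : 0 < η) : 0 < (haarProbability (Matrix.specialUnitaryGroup (Fin N) ℂ)).real {V : Matrix.specialUnitaryGroup (Fin N) ℂ | ‖(V : Matrix (Fin N) (Fin N) ℂ) - 1‖ ≤ η} := by
  have hN : (0 : ℝ) < N := by exact_mod_cast Nat.pos_of_ne_zero (NeZero.ne N)
  have hr : 0 < η / Real.sqrt N := div_pos hη (Real.sqrt_pos.2 hN)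
  exact lt_of_lt_of_le (by positivity) (haarReal_sball_ge_explicit hη)

/-! ## §2 The per-bond price with an explicit constant: `−log Haar(SB η) ≤ (N² − 1)·log η⁻¹ + c_N` -/

omit [NeZero N] in
/-- The logarithm of the explicit bound: for `r > 0`, `−log((4π∕((2N+1)r))·(r∕(16π+r))^{N²}) = (N² − 1)·log r⁻¹ + N²·log(16π + r) + log(2N + 1) − log(4π)`. [folklore] -/
theorem neg_log_explicitBound_eq {r : ℝ} (hr : 0 < r) :
    -Real.log (4 * π / ((2 * N + 1) * r) * (r / (16 * π + r)) ^ (N * N)) = ((N : ℝ) ^ 2 - 1) * Real.log r⁻¹ + (N : ℝ) ^ 2 * Real.log (16 * π + r) + Real.log (2 * N + 1) - Real.log (4 * π) := by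
  have hπ : 0 < π := Real.pi_pos
  have h1 : (0 : ℝ) < 2 * N + 1 := by positivity
  have h2 : 0 < 16 * π + r := by positivity
  rw [Real.log_mul (by positivity) (by positivity), Real.log_div (by positivity) (by positivity), Real.log_mul h1.ne' hr.ne', Real.log_pow,
    Real.log_div hr.ne' h2.ne', Real.log_inv]
  push_cast
  ring

/-- **THE PRICE WITH AN EXPLICIT CONSTANT, ALL `N ≥ 1`**: for `0 < η ≤ 2`,
`−log Haar_{SU(N)}{‖V − 1‖_HS ≤ η} ≤ (N² − 1)·log η⁻¹ + c_N`, `c_N = ((N² − 1)∕2)·log N + N²·log(16π + 2) + log(2N + 1) − log(4π)` (`log(η∕√N)⁻¹ = log η⁻¹ + ½log N`, and `η∕√N ≤ 2`). [folklore] -/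
theorem neg_log_haar_sball_le_explicit {η : ℝ} (hη : 0 < η) (hη2 : η ≤ 2) :
    -Real.log ((haarProbability (Matrix.specialUnitaryGroup (Fin N) ℂ)).real {V : Matrix.specialUnitaryGroup (Fin N) ℂ | ‖(V : Matrix (Fin N) (Fin N) ℂ) - 1‖ ≤ η}) ≤
      ((N : ℝ) ^ 2 - 1) * Real.log η⁻¹ + (((N : ℝ) ^ 2 - 1) / 2 * Real.log N + (N : ℝ) ^ 2 * Real.log (16 * π + 2) + Real.log (2 * N + 1) - Real.log (4 * π)) := by
  have hN : (0 : ℝ) < N := by exact_mod_cast Nat.pos_of_ne_zero (NeZero.ne N)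
  have hN1 : (1 : ℝ) ≤ N := by exact_mod_cast Nat.one_le_iff_ne_zero.2 (NeZero.ne N)
  have hsN : 0 < Real.sqrt N := Real.sqrt_pos.2 hN
  have hsN1 : 1 ≤ Real.sqrt N := by rw [← Real.sqrt_one]; exact Real.sqrt_le_sqrt hN1
  set r : ℝ := η / Real.sqrt N with hrdef
  have hr : 0 < r := div_pos hη hsN
  have hr2 : r ≤ 2 := (div_le_self hη.le hsN1).trans hη2
  have hπ : 0 < π := Real.pi_pos
  have hB : 0 < 4 * π / ((2 * N + 1) * r) * (r / (16 * π + r)) ^ (N * N) := by positivity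
  have hge := haarReal_sball_ge_explicit (N := N) hη
  -- `−log m ≤ −log(bound)`
  have hlog : -Real.log ((haarProbability (Matrix.specialUnitaryGroup (Fin N) ℂ)).real {V : Matrix.specialUnitaryGroup (Fin N) ℂ | ‖(V : Matrix (Fin N) (Fin N) ℂ) - 1‖ ≤ η}) ≤
      -Real.log (4 * π / ((2 * N + 1) * r) * (r / (16 * π + r)) ^ (N * N)) := neg_le_neg (Real.log_le_log hB hge)
  rw [neg_log_explicitBound_eq hr] at hlog
  -- `log r⁻¹ = log η⁻¹ + ½ log N`, `log(16π + r) ≤ log(16π + 2)`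
  have hlr : Real.log r⁻¹ = Real.log η⁻¹ + Real.log N / 2 := by
    rw [hrdef, inv_div, Real.log_div hsN.ne' hη.ne', Real.log_sqrt hN.le, Real.log_inv]; ring
  have hl16 : Real.log (16 * π + r) ≤ Real.log (16 * π + 2) := Real.log_le_log (by positivity) (by linarith)
  have hd0 : 0 ≤ (N : ℝ) ^ 2 - 1 := by nlinarith
  have hN2 : 0 ≤ (N : ℝ) ^ 2 := sq_nonneg _
  rw [hlr] at hlog
  nlinarith [mul_le_mul_of_nonneg_left hl16 hN2]

/-! ## §3 A region: the product window's price with the explicit constant, and the junction with the OWNER's display -/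

section Region

variable {B : Type*} [Fintype B]

/-- **THE PER-DEGREE-OF-FREEDOM PRICE BY VALUE, EXPLICIT, ALL `N ≥ 1`**: for `0 < η ≤ 2` the product window has positive mass and
`−log κ(Π_b SB η) ≤ #bonds·((N² − 1)·log η⁻¹ + c_N)`. [folklore] -/
theorem neg_log_pi_sball_le_explicit {η : ℝ} (hη : 0 < η) (hη2 : η ≤ 2) :
    0 < ((Measure.pi fun _ : B => haarProbability (Matrix.specialUnitaryGroup (Fin N) ℂ)) (Set.univ.pi fun _ : B => {V : Matrix.specialUnitaryGroup (Fin N) ℂ | ‖(V : Matrix (Fin N) (Fin N) ℂ) - 1‖ ≤ η})).toReal ∧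
      -Real.log ((Measure.pi fun _ : B => haarProbability (Matrix.specialUnitaryGroup (Fin N) ℂ)) (Set.univ.pi fun _ : B => {V : Matrix.specialUnitaryGroup (Fin N) ℂ | ‖(V : Matrix (Fin N) (Fin N) ℂ) - 1‖ ≤ η})).toReal ≤
        (Fintype.card B : ℝ) * (((N : ℝ) ^ 2 - 1) * Real.log η⁻¹ + (((N : ℝ) ^ 2 - 1) / 2 * Real.log N + (N : ℝ) ^ 2 * Real.log (16 * π + 2) + Real.log (2 * N + 1) - Real.log (4 * π))) := by
  have hpos := haar_sball_real_pos (N := N) hη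
  have hlog := neg_log_haar_sball_le_explicit (N := N) hη hη2
  rw [measureReal_def] at hpos hlog
  refine ⟨?_, ?_⟩
  · rw [CompactFibreWindowSUN.pi_sball_toReal_eq]; exact pow_pos hpos _
  · rw [CompactFibreWindowSUN.pi_sball_toReal_eq, Real.log_pow, ← mul_neg]
    exact mul_le_mul_of_nonneg_left hlog (Nat.cast_nonneg _)

/-- **THE JUNCTION WITH THE OWNER's DISPLAY, EXPLICIT** (V20's `compactFibre_moment_le_window_exp` BY NAME): on the near fibre `bonds → SU(N)` with the product Haar probability and the product
Hilbert–Schmidt window of size `0 < η ≤ 2`, a numerator factor `0 ≤ F ≤ 1` carried by POSITIVITY and an interaction `≤ i⁺` on the window give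
`∫ F·w·e^{−I} d(κ⊗μ) ≤ exp(i⁺ + #bonds·((N² − 1)·log η⁻¹ + c_N)) · ∫ 𝟙_W·w·e^{−I} d(κ⊗μ)`. [folklore] -/
theorem compactFibre_moment_le_SUNwindow_explicit {Y : Type*} [MeasurableSpace Y] (μ : Measure Y) [SFinite μ] {η : ℝ} (hη : 0 < η) (hη2 : η ≤ 2)
    (F : (B → (Matrix.specialUnitaryGroup (Fin N) ℂ)) → ℝ) (w : Y → ℝ) (I : (B → (Matrix.specialUnitaryGroup (Fin N) ℂ)) × Y → ℝ) (ip : ℝ)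
    (hF0 : ∀ x, 0 ≤ F x) (hF1 : ∀ x, F x ≤ 1) (hFi : Integrable F (Measure.pi fun _ : B => haarProbability (Matrix.specialUnitaryGroup (Fin N) ℂ))) (hw0 : ∀ y, 0 ≤ w y)
    (hIpos : ∀ z : (B → (Matrix.specialUnitaryGroup (Fin N) ℂ)) × Y, F z.1 ≠ 0 → w z.2 ≠ 0 → 0 ≤ I z)
    (hIsmall : ∀ z : (B → (Matrix.specialUnitaryGroup (Fin N) ℂ)) × Y, z.1 ∈ (Set.univ.pi fun _ : B => {V : Matrix.specialUnitaryGroup (Fin N) ℂ | ‖(V : Matrix (Fin N) (Fin N) ℂ) - 1‖ ≤ η}) → w z.2 ≠ 0 → I z ≤ ip)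
    (hA : Integrable (fun z : (B → (Matrix.specialUnitaryGroup (Fin N) ℂ)) × Y => F z.1 * w z.2) ((Measure.pi fun _ : B => haarProbability (Matrix.specialUnitaryGroup (Fin N) ℂ)).prod μ))
    (hB' : Integrable (fun z : (B → (Matrix.specialUnitaryGroup (Fin N) ℂ)) × Y => (Set.univ.pi fun _ : B => {V : Matrix.specialUnitaryGroup (Fin N) ℂ | ‖(V : Matrix (Fin N) (Fin N) ℂ) - 1‖ ≤ η}).indicator 1 z.1 * w z.2 * exp (-I z))
      ((Measure.pi fun _ : B => haarProbability (Matrix.specialUnitaryGroup (Fin N) ℂ)).prod μ)) :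
    ∫ z, F z.1 * w z.2 * exp (-I z) ∂((Measure.pi fun _ : B => haarProbability (Matrix.specialUnitaryGroup (Fin N) ℂ)).prod μ) ≤
      exp (ip + (Fintype.card B : ℝ) * (((N : ℝ) ^ 2 - 1) * Real.log η⁻¹ + (((N : ℝ) ^ 2 - 1) / 2 * Real.log N + (N : ℝ) ^ 2 * Real.log (16 * π + 2) + Real.log (2 * N + 1) - Real.log (4 * π)))) *
        ∫ z, (Set.univ.pi fun _ : B => {V : Matrix.specialUnitaryGroup (Fin N) ℂ | ‖(V : Matrix (Fin N) (Fin N) ℂ) - 1‖ ≤ η}).indicator 1 z.1 * w z.2 * exp (-I z)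
          ∂((Measure.pi fun _ : B => haarProbability (Matrix.specialUnitaryGroup (Fin N) ℂ)).prod μ) := by
  obtain ⟨hpos, hlog⟩ := neg_log_pi_sball_le_explicit (N := N) (B := B) hη hη2
  exact CompactFibreWindowSU2.compactFibre_moment_le_window_exp (Measure.pi fun _ : B => haarProbability (Matrix.specialUnitaryGroup (Fin N) ℂ)) μ _
    (MeasurableSet.univ_pi fun _ => CompactFibreWindowSUN.measurableSet_sball η) F w I hF0 hF1 hFi hw0 hIpos hIsmall hpos hlog hA hB'

end Region

/-! ## §4 Sanity: the constant for `N = 2` and `N = 3` in closed form -/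

/-- `c_2 = (3∕2)·log 2 + 4·log(16π + 2) + log 5 − log(4π)`. -/
example : (((2 : ℕ) : ℝ) ^ 2 - 1) / 2 * Real.log (2 : ℕ) + ((2 : ℕ) : ℝ) ^ 2 * Real.log (16 * π + 2) + Real.log (2 * (2 : ℕ) + 1) - Real.log (4 * π) =
    3 / 2 * Real.log 2 + 4 * Real.log (16 * π + 2) + Real.log 5 - Real.log (4 * π) := by norm_num

end HS

end

end Summit.QuantumFields.BalabanUV.T4Continuum.NE7b.CompactFibreWindowSUNExplicit
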